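import Mathlib
import HarnessLib

/-!
# Route NewtonUnitEquations — crux `TwoProducts` (stmt-ValiantsHypothesis-5906), line `relation_ladder`, rung R8 ingredient: the SIMPLEX
# slice count (`#W k n ≤ 2^(n+k)` for weak compositions)

val-idea-8 g3 (ideator), 2026-08-28: `W k n` = the weak compositions `w : Fin k → ℕ` with `∑ w ≤ n`; `card_W_le : #W k n ≤ 2^(n+k)` (fibration over
`w 0` + a geometric sum), `card_W_le_of_le` (`k ≤ n+1 ⇒ ≤ 2^(2n+1)`), `card_image_le_of_factor` (a family of slice vectors indexed by anything that
FACTORS through `W k n` has at most `2^(n+k)` values — the form the R8 count consumes).  In the R8 engine (memo `Lines/relation_ladder_R8_engine.md`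
§3; one-sided rank one `p•α = Σ_{i<k} q_i•β_i`) the slice vector of a visible point is a function of `(L₀(a), (L₀(bI i))_{i<k}) ∈ W (k+1) m`
(`deg L₀ ≤ m`), so the number of slices is `≤ 2^(m+k+1) ≤ 2^(2m+2)` — in the format `2^{cm}(#T+2)^c` (a BOX of slices would be `(2m²+1)^k`, out
of format).

PORT NOTE (val-lit-p3 g15, prover seat, helper mode `--supports stmt-ValiantsHypothesis-5906 --as helper`): VERBATIM Theorems-side port of
val-idea-8 g3's sorry-free workfile `Cruxes/TwoProducts/Lines/relation_ladder_R8_simplex.lean` @ead90f00b8e8 (rc 0, 0 sorries, 0 warnings); only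
the module docstring, one lemma docstring and `import HarnessLib` are added.  Namespace = the author's (`…PermutationType.R8`).  Pure finite
combinatorics; nothing here closes the line's residual, the crux `TwoProducts` (5906) or `VP ≠ VNP`. [folklore]
-/

set_option linter.dupNamespace false

namespace Summit.ValiantsHypothesis.ValiantsHypothesis.Theorems.NewtonUnitEquations.TwoProducts.PermutationType.R8

open Finset

/-- Weak compositions of numbers `≤ n` into `k` parts: `w : Fin k → ℕ` with `∑ i, w i ≤ n`. -/
def W (k n : ℕ) : Finset (Fin k → ℕ) :=
  (Fintype.piFinset fun _ : Fin k => range (n + 1)).filter fun w => ∑ i, w i ≤ n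

/-- Membership in `W k n`: the sum of the parts is at most `n`. [folklore] -/
theorem mem_W {k n : ℕ} {w : Fin k → ℕ} : w ∈ W k n ↔ ∑ i, w i ≤ n := by
  unfold W
  simp only [mem_filter, Fintype.mem_piFinset, mem_range]
  constructor
  · exact fun h => h.2
  · intro h
    refine ⟨fun i => ?_, h⟩
    have := Finset.single_le_sum (f := w) (fun j _ => Nat.zero_le _) (mem_univ i)
    omega

/-- `∑_{j ≤ n} 2^(n-j+c) + 2^c = 2^(n+1+c)`. -/
theorem geom_aux (c : ℕ) : ∀ n : ℕ, ∑ j ∈ range (n + 1), 2 ^ (n - j + c) + 2 ^ c = 2 ^ (n + 1 + c) := by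
  intro n
  induction n with
  | zero => simp; ring
  | succ n ih =>
    rw [sum_range_succ, show n + 1 - (n + 1) + c = c by simp]
    have h1 : ∑ j ∈ range (n + 1), 2 ^ (n + 1 - j + c) = 2 * ∑ j ∈ range (n + 1), 2 ^ (n - j + c) := by
      rw [mul_sum]
      refine sum_congr rfl fun j hj => ?_
      rw [mem_range] at hj
      rw [show n + 1 - j + c = (n - j + c) + 1 by omega, pow_succ]
      ring
    rw [h1]
    have h2 := ih
    calc 2 * ∑ j ∈ range (n + 1), 2 ^ (n - j + c) + 2 ^ c + 2 ^ c
        = 2 * (∑ j ∈ range (n + 1), 2 ^ (n - j + c) + 2 ^ c) := by ring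
      _ = 2 * 2 ^ (n + 1 + c) := by rw [h2]
      _ = 2 ^ (n + 1 + 1 + c) := by rw [show n + 1 + 1 + c = (n + 1 + c) + 1 by ring, pow_succ]; ring

/-- **The simplex count**: `#W k n ≤ 2^(n+k)`. -/
theorem card_W_le : ∀ k n : ℕ, (W k n).card ≤ 2 ^ (n + k) := by
  intro k
  induction k with
  | zero =>
    intro n
    calc (W 0 n).card ≤ (Fintype.piFinset fun _ : Fin 0 => range (n + 1)).card := card_filter_le _ _
      _ = 1 := by simp
      _ ≤ 2 ^ (n + 0) := Nat.one_le_two_pow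
  | succ k ih =>
    intro n
    have hfib : (W (k + 1) n).card = ∑ j ∈ range (n + 1), ((W (k + 1) n).filter fun w => w 0 = j).card := by
      refine card_eq_sum_card_fiberwise fun w hw => ?_
      have := mem_W.1 hw
      rw [Fin.sum_univ_succ] at this
      rw [mem_coe, mem_range]
      omega
    have hle : ∀ j ∈ range (n + 1), ((W (k + 1) n).filter fun w => w 0 = j).card ≤ (W k (n - j)).card := by
      intro j hj
      refine card_le_card_of_injOn (fun (w : Fin (k + 1) → ℕ) (i : Fin k) => w i.succ) ?_ ?_
      · intro w hw
        rw [mem_coe, mem_filter] at hw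
        rw [mem_coe, mem_W]
        have h := mem_W.1 hw.1
        rw [Fin.sum_univ_succ, hw.2] at h
        show ∑ i : Fin k, w i.succ ≤ n - j
        omega
      · intro w hw w' hw' h
        rw [mem_coe, mem_filter] at hw hw'
        funext i
        refine Fin.cases ?_ (fun i' => ?_) i
        · rw [hw.2, hw'.2]
        · exact congrFun h i'
    rw [hfib]
    calc ∑ j ∈ range (n + 1), ((W (k + 1) n).filter fun w => w 0 = j).card
        ≤ ∑ j ∈ range (n + 1), (W k (n - j)).card := sum_le_sum hle
      _ ≤ ∑ j ∈ range (n + 1), 2 ^ (n - j + k) := sum_le_sum fun j _ => ih (n - j)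
      _ ≤ ∑ j ∈ range (n + 1), 2 ^ (n - j + k) + 2 ^ k := Nat.le_add_right _ _
      _ = 2 ^ (n + 1 + k) := geom_aux k n
      _ = 2 ^ (n + (k + 1)) := by ring_nf

/-- Format corollary: with `k ≤ n + 1` parts, `#W k n ≤ 2^(2n+1)`. -/
theorem card_W_le_of_le {k n : ℕ} (hk : k ≤ n + 1) : (W k n).card ≤ 2 ^ (2 * n + 1) :=
  (card_W_le k n).trans (Nat.pow_le_pow_right (by norm_num) (by omega))

/-- How the engine uses it: a family of "slice vectors" indexed by anything that FACTORS through `W k n` has at most `2^(n+k)` values. -/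
theorem card_image_le_of_factor {ι β : Type*} [DecidableEq β] (s : Finset ι) (k n : ℕ) (w : ι → (Fin k → ℕ))
    (hw : ∀ x ∈ s, w x ∈ W k n) (g : (Fin k → ℕ) → β) :
    (s.image fun x => g (w x)).card ≤ 2 ^ (n + k) := by
  calc (s.image fun x => g (w x)).card ≤ ((W k n).image g).card := by
        refine card_le_card fun y hy => ?_
        rw [mem_image] at hy ⊢
        obtain ⟨x, hx, rfl⟩ := hy
        exact ⟨w x, hw x hx, rfl⟩
    _ ≤ (W k n).card := card_image_le
    _ ≤ 2 ^ (n + k) := card_W_le k n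

end Summit.ValiantsHypothesis.ValiantsHypothesis.Theorems.NewtonUnitEquations.TwoProducts.PermutationType.R8
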